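import Summits.ResolutionOfSingularities.ResolutionOfSingularities.Theorems.FrobeniusLadderFInjectiveMacaulayficationNonFullCentreOfLocus
import Summits.ResolutionOfSingularities.ResolutionOfSingularities.Theorems.FrobeniusLadderFInjectiveMacaulayficationNonFullLoopFloorTwoLocus
import Summits.ResolutionOfSingularities.ResolutionOfSingularities.Theorems.FrobeniusLadderFInjectiveMacaulayficationNonFullLoopFloorZero
import Summits.ResolutionOfSingularities.ResolutionOfSingularities.Theorems.FrobeniusLadderFInjectiveMacaulayficationNonFullLoopFloorFourLocus
import Summits.ResolutionOfSingularities.ResolutionOfSingularities.Theorems.FrobeniusLadderFInjectiveMacaulayficationNonFullCentreComap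
import Summits.ResolutionOfSingularities.ResolutionOfSingularities.Theorems.FrobeniusLadderFInjectiveMacaulayficationLx6c3PointFloor
import Summits.ResolutionOfSingularities.ResolutionOfSingularities.Theorems.FrobeniusLadderFInjectiveMacaulayficationLx6c3PointFloorCharts
import Summits.ResolutionOfSingularities.ResolutionOfSingularities.Theorems.FrobeniusLadderFInjectiveMacaulayficationLx6c3Specimen
import Summits.ResolutionOfSingularities.ResolutionOfSingularities.Theorems.FrobeniusLadderFInjectiveMacaulayficationNonFullLoopFloorOne
import Summits.ResolutionOfSingularities.ResolutionOfSingularities.Theorems.FrobeniusLadderFInjectiveMacaulayficationFTemkinClosedPoints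
import Summits.ResolutionOfSingularities.ResolutionOfSingularities.Theorems.FrobeniusLadderFInjectiveMacaulayficationFermatCubicConeGerm
import Literature.AlgebraicGeometry.Resolution.BlowupsFlatBaseChange
import Literature.AlgebraicGeometry.Resolution.AffineBlowupUnique
import Mathlib.Algebra.Field.ZMod
import HarnessLib

/-!
# NEG-A: ★★★ `¬ Recipes.NonFullTowerConjecture` — OUR OWN N_red-tower candidate is FALSE, hypothesis-free in the kernel
# (crux `FInjectiveMacaulayfication` stmt-ResolutionOfSingularities-15315, chain w45a; res-L1-w45a-plan-1 RULINGS R19.21 «NEG-N» / R19.23 «GAP (LOC)» / R21.1 / R21.2 (2):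
# filer res-L1-w45a-stub-1 g12; TEXT = res-L1-w45a-tri-2 g16's plug section `g16/NEGA-plugC-section.lean` bdc42a35955470c5 (theorems (c), (d), (f)) VERBATIM modulo
# namespace/imports/docstrings — its scratch variant (e) with a private floor-0 link is omitted in favour of res-L1-w45a-stub-3's landed ✓ p648330 by name)

[OURS · L1 W4.5a] Negative file for the crux's OWN auxiliary candidate: `IntrinsicTower.Recipes.NonFullTowerConjecture := TowerTerminates nonFullCentre` (✓ p632743, `@[conjecture]`,
OURS — the «N_red» recipe variant of the F-half engine, ALREADY REFUTED BY EVIDENCE R19.7/R19.16) is here REFUTED IN THE KERNEL, UNCONDITIONALLY. This does NOT refute the crux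
`FInjectiveMacaulayfication`, NOR any route decl, NOR the conjecture of record `TauTowerConjecture` (refuted by evidence only; kernel record conditional, ✓ p642899/p645306);
it replaces the role of NO printed item and is NOT a statement of any manuscript. `--supports stmt-ResolutionOfSingularities-15315`. AI-written assembly of kernel-checked
parts (AI review is weaker than expert review).

THE ARGUMENT (bed d4lx6c3: `X = Spec k[x,y,u,t,z]/(z² + x⁶z + y³ + u³ + t³)`, `char k = 2`, `v` = the isolated singular point; floor table res-L1-w45a-tri-2 l.81567, cross-checked
res-L1-w45a-idea-1 FB5-r6 §1.5):
* NEG-0 (res-L1-w45a-stub-3 ✓ p646544 / p647036 / p647478): every binder of `TowerTerminates` holds at the point floor of `X` at `v`, so the conjecture yields a terminating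
  N_red-tower on the LOCAL floor `Bl_𝔪 X ×_X Spec 𝒪_{X,v}` (`Lx6c3PointFloor.recipeTowerFull_of_towerTerminates`);
* NEG-T (res-L1-w45a-lead-1 ✓ p646420 / p647370): terminating N_red-towers transfer from the local floor to the GLOBAL floor `T = Bl_𝔪 X` (flat-preimmersion induction,
  `RecipeTowerTransfer.exists_recipeTowerFull_nonFullCentre_of_pullback_fromSpecStalk'`), `T` being FULL off the fibre (regular there: `Lx6c3Specimen.regular_off_vertex`);
* NEG-0…5 (stub-3: floors 0, 2, 4 ✓ p648330 / p647621 + p648089 / p647126 + p647902; stub-1: floors 1, 3, 5 ✓ p643973 + p646599 / p644128 + p647439 / p645904 + p647546, links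
  ✓ p648692; frame res-L1-w45a-lead-1 ✓ p645060): the chart path `U₁ ↪° T`, `U_{k+1} ↪°` every blowing up of `U_k` along its N-centre (two-sided locus lemmas: the N-centre of
  `U_k` IS the coordinate prime `S_k`; chart identities `g_k(θ) = x²·g_{k+1}`), and `U₅ = U₀ ↪°` every N-blow-up of `U₀` (period one: `g₅(x, xy, u, t, xz) = x²·g₅`);
* the recurrent-FAMILY lemma (res-L1-w45a-stub-2/lead-1 kit ✓ p635381 `FullCentreDescent.not_exists_tower_of_recurrent_family`, `ι := Fin 5`): a family of non-FULL charts each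
  of whose N-blow-ups contains another member refutes every terminating N_red-tower on every scheme containing one of them — contradiction at `T ⊇° U₁`.
* `not_nonFullTowerConjecture_of_hfull_of_floor0_link` (modulo `hfull`, floor-0 link) → `not_nonFullTowerConjecture_of_floor0_link` (`hfull` discharged: blow-up iso off the
  centre + regular ⇒ FULL) → ★★★ `not_nonFullTowerConjecture_over (k) [Field k] [CharP k 2]` → ★★★ `not_nonFullTowerConjecture` (`k := ZMod 2`).
[folklore assembly of OURS certificates; cite: GortzWedhorn2020, Prop. 13.91 (2) and (13.19); Fedder1983, Prop. 1.7 and Thm. 1.12; StacksProject, Tag 0804 and Tag 080E]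
-/

-- single-problem summit: the doubled namespace component is forced
set_option linter.dupNamespace false

noncomputable section

namespace Summit.ResolutionOfSingularities.ResolutionOfSingularities.Theorems.FInjectiveMacaulayfication.Negative.NonFullTowerConjecture

open Summit.ResolutionOfSingularities.ResolutionOfSingularities.Theorems.FInjectiveMacaulayfication
open SliceableCentre IntrinsicTower IntrinsicTower.Recipes FullCentreDescent
open AlgebraicGeometry CategoryTheory CategoryTheory.Limits Literature.AlgebraicGeometry.Resolution TopologicalSpace IsLocalRing MvPolynomial

/-- ★★ **`¬ NonFullTowerConjecture` MODULO the two floor-0 data** `hfull` (the global floor `T ⟶ X`, any blowing up of the bed along `𝔪`, is FULL off `v`) and the floor-0 link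
`U₁ ↪° T`: NEG-0 + NEG-T put a terminating N_red-tower on `T`; the recurrent family `U₁, …, U₅ = U₀` of non-FULL charts (floors 1–5, two-sided locus lemmas + chart links, the last
one a loop) forbids it (`FullCentreDescent.not_exists_tower_of_recurrent_family`, `ι := Fin 5`). [OURS · text res-L1-w45a-tri-2 g16 plug (c) verbatim] -/
theorem not_nonFullTowerConjecture_of_hfull_of_floor0_link (k : Type) [Field k] [CharP k 2]
    (f : MvPolynomial (Fin 5) k) (hf : f = X 4 ^ 2 + X 0 ^ 6 * X 4 + X 1 ^ 3 + X 2 ^ 3 + X 3 ^ 3)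
    (v : Spec (.of (MvPolynomial (Fin 5) k ⧸ Ideal.span {f})))
    (hv : v.asIdeal = Ideal.span (Set.range fun j : Fin 5 => Ideal.Quotient.mk (Ideal.span {f}) (X j)))
    {T : Scheme.{0}} (h : T ⟶ Spec (.of (MvPolynomial (Fin 5) k ⧸ Ideal.span {f})))
    (hT : IsBlowup h (affineBlowup.idealSheaf (Ideal.span (Set.range fun j : Fin 5 => Ideal.Quotient.mk (Ideal.span {f}) (X j)))))
    (hfull : ∀ s : T, h.base s ≠ v → FullCl 2 (T.presheaf.stalk s))
    (g₁ : MvPolynomial (Fin 5) k) (hg₁ : g₁ = X 4 ^ 2 + X 0 ^ 5 * X 4 + X 0 * X 1 ^ 3 + X 0 * X 2 ^ 3 + X 0 * X 3 ^ 3)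
    (h01 : ∃ j : Spec (.of (MvPolynomial (Fin 5) k ⧸ Ideal.span {g₁})) ⟶ T, IsOpenImmersion j) :
    ¬ NonFullTowerConjecture := by
  classical
  haveI : Fact (Nat.Prime 2) := ⟨Nat.prime_two⟩
  intro hC
  -- (plug (b)) the conjecture bounds the N_red-towers of the GLOBAL floor `T`
  haveI : Flat ((Spec (.of (MvPolynomial (Fin 5) k ⧸ Ideal.span {f}))).fromSpecStalk v) := flat_fromSpecStalk _ v
  have hb : ∃ n : ℕ, RecipeTowerFull nonFullCentre 2 n T :=
    RecipeTowerTransfer.exists_recipeTowerFull_nonFullCentre_of_pullback_fromSpecStalk' 2 h v (Lx6c3Specimen.isClosed_vertex k f hf v hv) hfull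
      (Lx6c3PointFloor.recipeTowerFull_of_towerTerminates nonFullCentre hC k f hf v hv _ (pullback.snd h _) (hT.pullback_snd_of_flat _))
  -- the letters of floors 2 … 5 (tri-2 floor table g16/NEGN-d4lx6c3-floors.txt)
  obtain ⟨g₂, hg₂⟩ : ∃ g₂ : MvPolynomial (Fin 5) k, g₂ = X 4 ^ 2 + X 0 ^ 4 * X 4 + X 0 ^ 2 * X 1 ^ 3 + X 0 ^ 2 * X 2 ^ 3 + X 0 ^ 2 * X 3 ^ 3 := ⟨_, rfl⟩
  obtain ⟨g₃, hg₃⟩ : ∃ g₃ : MvPolynomial (Fin 5) k, g₃ = X 4 ^ 2 + X 0 ^ 3 * X 4 + X 1 ^ 3 + X 2 ^ 3 + X 3 ^ 3 := ⟨_, rfl⟩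
  obtain ⟨g₄, hg₄⟩ : ∃ g₄ : MvPolynomial (Fin 5) k, g₄ = X 4 ^ 2 + X 0 ^ 2 * X 4 + X 0 * X 1 ^ 3 + X 0 * X 2 ^ 3 + X 0 * X 3 ^ 3 := ⟨_, rfl⟩
  obtain ⟨g₅, hg₅⟩ : ∃ g₅ : MvPolynomial (Fin 5) k,
      g₅ = X 4 ^ 2 + X 0 ^ 2 * X 1 * X 4 + X 0 * X 1 ^ 2 * X 2 ^ 3 + X 0 * X 1 ^ 2 * X 3 ^ 3 + X 0 * X 1 ^ 2 := ⟨_, rfl⟩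
  -- primality of the two non-generic centres' ambient data (floor 2: (x̄, z̄); floor 4: the origin)
  haveI := (NonFullLoopFloorOne.isPrime_span_g₂ k _ rfl g₂ hg₂).2
  haveI : IsDomain (MvPolynomial (Fin 5) k ⧸ Ideal.span {g₂}) := Ideal.Quotient.isDomain _
  haveI hP₂ : (Ideal.span ((fun j : Fin 5 => Ideal.Quotient.mk (Ideal.span {g₂}) (X j)) '' (({0, 4} : Finset (Fin 5)) : Set (Fin 5)))).IsPrime :=
    NonFullLoopFloorFive.isPrime_span_image_mk k g₂ _ (NonFullLoopFloorTwo.g₂_mem_span_X_image k g₂ hg₂ _ (by simp) (by simp))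
  haveI hM₄ := NonFullLoopFloorFour.isMaximal_origin k g₄ hg₄
  -- the family of germs U₁ … U₅
  let R : Fin 5 → MvPolynomial (Fin 5) k := ![g₁, g₂, g₃, g₄, g₅]
  let U : Fin 5 → Scheme.{0} := fun i => Spec (.of (MvPolynomial (Fin 5) k ⧸ Ideal.span {R i}))
  have hU : ∀ i, ∃ u : U i, ¬ FullCl 2 ((U i).presheaf.stalk u) := by
    intro i
    fin_cases i
    · exact NonFullLoopFloorOne.exists_not_fullCl k g₁ hg₁
    · exact ⟨⟨_, hP₂⟩, (NonFullLoopFloorTwo.not_fullCl_stalk_iff_centre_le k g₂ hg₂ _).mpr le_rfl⟩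
    · exact NonFullLoopFloorThree.exists_not_fullCl k g₃ hg₃
    · exact ⟨⟨_, hM₄.isPrime'⟩, (NonFullLoopFloorFour.not_fullCl_stalk_iff_origin_le k g₄ hg₄ _).mpr le_rfl⟩
    · exact NonFullLoopFloorFive.exists_not_fullCl k g₅ hg₅
  have hrec : ∀ (i : Fin 5) (B : Scheme.{0}) (π : B ⟶ U i), IsBlowup π (nonFullCentre 2 (U i)) →
      ∃ (i' : Fin 5) (j : U i' ⟶ B), IsOpenImmersion j := by
    intro i
    fin_cases i <;> intro B π hπ
    · obtain ⟨j, hj⟩ := NonFullLoopFloorOne.exists_isOpenImmersion_of_isBlowup k g₁ hg₁ g₂ hg₂ B π hπ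
      exact ⟨1, j, hj⟩
    · obtain ⟨j₀, hj₀⟩ := NonFullLoopFloorTwo.exists_chart_isOpenImmersion k g₂ hg₂ g₃ hg₃
      haveI := hj₀
      obtain ⟨j, hj⟩ := NonFullCentreOfLocus.exists_isOpenImmersion_of_isBlowup_nonFullCentre 2 k _
        (NonFullLoopFloorTwo.not_fullCl_stalk_iff_centre_le k g₂ hg₂) j₀ B π hπ
      exact ⟨2, j, hj⟩
    · obtain ⟨j, hj⟩ := NonFullLoopFloorThree.exists_isOpenImmersion_of_isBlowup k g₃ hg₃ g₄ hg₄ B π hπ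
      exact ⟨3, j, hj⟩
    · obtain ⟨j₀, hj₀⟩ := NonFullLoopFloorFour.exists_chart_isOpenImmersion k g₄ hg₄ g₅ hg₅
      haveI := hj₀
      obtain ⟨j, hj⟩ := NonFullCentreOfLocus.exists_isOpenImmersion_of_isBlowup_nonFullCentre 2 k _
        (NonFullLoopFloorFour.not_fullCl_stalk_iff_origin_le k g₄ hg₄) j₀ B π hπ
      exact ⟨4, j, hj⟩
    · obtain ⟨j, hj⟩ := NonFullLoopFloorFive.exists_isOpenImmersion_of_isBlowup k g₅ hg₅ B π hπ
      exact ⟨4, j, hj⟩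
  obtain ⟨j01, hj01⟩ := h01
  exact not_exists_tower_of_recurrent_family (fun S s => FullCl 2 (S.presheaf.stalk s)) (fun π x _ h => fullCl_descends 2 π x h)
    (RecipeTowerFull nonFullCentre 2) (nonFullCentre 2) (fun _ h => h) (fun _ _ h => h) (fun j _ => nonFullCentreLiteral_local 2 j)
    U hU hrec T ⟨0, j01, hj01⟩ hb

/-- ★★ **`hfull` DISCHARGED** — any blowing up `T ⟶ X` of the bed along `𝔪` is FULL off `v`: a blowing up is a stalk-isomorphism off the support `{v}` of its centre
(`IsBlowup.isIso_stalkMap_of_not_mem_support`), `X` is regular off `v` (`Lx6c3Specimen.regular_off_vertex`), and regular ⇒ FULL (`FTemkinClosedPoints.fullCl_of_isRegularLocalRing`).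
So `¬ NonFullTowerConjecture` holds MODULO ONLY the floor-0 link. [OURS · text res-L1-w45a-tri-2 g16 plug (d) verbatim] -/
theorem not_nonFullTowerConjecture_of_floor0_link (k : Type) [Field k] [CharP k 2]
    (f : MvPolynomial (Fin 5) k) (hf : f = X 4 ^ 2 + X 0 ^ 6 * X 4 + X 1 ^ 3 + X 2 ^ 3 + X 3 ^ 3)
    (v : Spec (.of (MvPolynomial (Fin 5) k ⧸ Ideal.span {f})))
    (hv : v.asIdeal = Ideal.span (Set.range fun j : Fin 5 => Ideal.Quotient.mk (Ideal.span {f}) (X j)))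
    {T : Scheme.{0}} (h : T ⟶ Spec (.of (MvPolynomial (Fin 5) k ⧸ Ideal.span {f})))
    (hT : IsBlowup h (affineBlowup.idealSheaf (Ideal.span (Set.range fun j : Fin 5 => Ideal.Quotient.mk (Ideal.span {f}) (X j)))))
    (g₁ : MvPolynomial (Fin 5) k) (hg₁ : g₁ = X 4 ^ 2 + X 0 ^ 5 * X 4 + X 0 * X 1 ^ 3 + X 0 * X 2 ^ 3 + X 0 * X 3 ^ 3)
    (h01 : ∃ j : Spec (.of (MvPolynomial (Fin 5) k ⧸ Ideal.span {g₁})) ⟶ T, IsOpenImmersion j) :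
    ¬ NonFullTowerConjecture := by
  classical
  haveI : Fact (Nat.Prime 2) := ⟨Nat.prime_two⟩
  refine not_nonFullTowerConjecture_of_hfull_of_floor0_link k f hf v hv h hT ?_ g₁ hg₁ h01
  intro s hs
  have hM : (Ideal.span (Set.range fun j : Fin 5 => Ideal.Quotient.mk (Ideal.span {f}) (X j))).IsMaximal :=
    DoublePointFermatCubicGerm.isMaximal_origin k f (Lx6c3Specimen.constantCoeff_f k f hf)
  have hne : ¬ Ideal.span (Set.range fun j : Fin 5 => Ideal.Quotient.mk (Ideal.span {f}) (X j)) ≤ (h.base s).asIdeal := by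
    intro hle
    exact hs (PrimeSpectrum.ext ((hM.eq_of_le (h.base s).isPrime.ne_top hle).symm.trans hv.symm))
  have hnot : h.base s ∉ ((affineBlowup.idealSheaf (Ideal.span (Set.range fun j : Fin 5 => Ideal.Quotient.mk (Ideal.span {f}) (X j)))).support :
      Set (Spec (.of (MvPolynomial (Fin 5) k ⧸ Ideal.span {f})))) := by
    rw [affineBlowup.support_idealSheaf]
    intro hmem
    exact hne (SetLike.coe_subset_coe.mp ((PrimeSpectrum.mem_zeroLocus (h.base s) _).mp hmem))
  haveI := hT.isIso_stalkMap_of_not_mem_support hnot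
  have hreg : h.base s ∈ Scheme.regularLocus (Spec (.of (MvPolynomial (Fin 5) k ⧸ Ideal.span {f}))) :=
    FermatCubicConeGerm.mem_regularLocus_Spec_of_isRegularLocalRing _ (Lx6c3Specimen.regular_off_vertex k f hf _ hne)
  haveI : IsRegularLocalRing ((Spec (.of (MvPolynomial (Fin 5) k ⧸ Ideal.span {f}))).presheaf.stalk (h.base s)) := hreg
  haveI : CharP ((Spec (.of (MvPolynomial (Fin 5) k ⧸ Ideal.span {f}))).presheaf.stalk (h.base s)) 2 :=
    FTemkinClosedPoints.charP_stalk_of_over 2 (Spec.map (CommRingCat.ofHom (algebraMap k (MvPolynomial (Fin 5) k ⧸ Ideal.span {f})))) (𝟙 _) (h.base s)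
  exact FTemkinClosedPoints.fullCl_of_isIso_stalkMap' 2 h s (FTemkinClosedPoints.fullCl_of_isRegularLocalRing 2 _)

/-- ★★★ **`¬ NonFullTowerConjecture` OVER ANY FIELD OF CHARACTERISTIC 2, EVERYTHING DISCHARGED**: the floor-0 link is res-L1-w45a-stub-3's ✓ p648330
`NonFullLoopFloorZero.exists_chart_isOpenImmersion` (`U₁ = Spec k[X]/(g₁)` is the `x`-chart of `Bl_𝔪 X`), the global floor is `affineBlowup.π 𝔪`. [OURS · text res-L1-w45a-tri-2 g16
plug (f) verbatim] -/
theorem not_nonFullTowerConjecture_over (k : Type) [Field k] [CharP k 2] : ¬ NonFullTowerConjecture := by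
  classical
  obtain ⟨f, hf⟩ : ∃ f : MvPolynomial (Fin 5) k, f = X 4 ^ 2 + X 0 ^ 6 * X 4 + X 1 ^ 3 + X 2 ^ 3 + X 3 ^ 3 := ⟨_, rfl⟩
  obtain ⟨g₁, hg₁⟩ : ∃ g₁ : MvPolynomial (Fin 5) k, g₁ = X 4 ^ 2 + X 0 ^ 5 * X 4 + X 0 * X 1 ^ 3 + X 0 * X 2 ^ 3 + X 0 * X 3 ^ 3 := ⟨_, rfl⟩
  have hM : (Ideal.span (Set.range fun j : Fin 5 => Ideal.Quotient.mk (Ideal.span {f}) (X j))).IsMaximal :=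
    DoublePointFermatCubicGerm.isMaximal_origin k f (Lx6c3Specimen.constantCoeff_f k f hf)
  exact not_nonFullTowerConjecture_of_floor0_link k f hf ⟨_, hM.isPrime'⟩ rfl (affineBlowup.π _) (affineBlowup.isBlowup _) g₁ hg₁
    (NonFullLoopFloorZero.exists_chart_isOpenImmersion k f hf g₁ hg₁)

/-- ★★★ **OUR N_red-TOWER CANDIDATE `Recipes.NonFullTowerConjecture` IS FALSE — HYPOTHESIS-FREE** (instantiate `k := ZMod 2`). What is refuted: «from every admissible CM floor
of an isolated singularity of dimension ≥ 4, the tower of blowing ups along the reduced closure of the non-FULL locus reaches, after finitely many floors, a scheme FULL at every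
stalk» — the period-one loop `g₅ ↦ g₅` on the bed d4lx6c3 (res-L1-w45a-idea-1 FB5-r6, res-L1-w45a-tri-2 l.81567) is now a kernel theorem end to end. NOT refuted: the crux, any
route decl, `TauTowerConjecture`. [OURS · unconditional; text res-L1-w45a-tri-2 g16 plug (f)] -/
theorem not_nonFullTowerConjecture : ¬ NonFullTowerConjecture := by
  haveI : Fact (Nat.Prime 2) := ⟨Nat.prime_two⟩
  exact not_nonFullTowerConjecture_over (ZMod 2)

end Summit.ResolutionOfSingularities.ResolutionOfSingularities.Theorems.FInjectiveMacaulayfication.Negative.NonFullTowerConjecture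

end
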